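import Summits.MatrixMultiplication.OmegaCensus.STPPSmallPatternKernelSearchStab
import Summits.MatrixMultiplication.OmegaCensus.STPPSmallPatternKernelProduct

/-!
# ω-census, `(2,1,1)^6` is infeasible in `ℤ/3 × ℤ/9` — kernel search (stabiliser normal form), part 9 of 13

HONEST FRAMING (pub-omega census; verbatim): lottery ticket; floor = certified bounds/negative ranges.
Census STRUCTURE bookkeeping of the STPP track (seat pub-omega-eng2 = ENG2, gen 34, on the kernel engine of seat pub-omega-stpp-3 gen 23
with the stabiliser normal form / global mask of `STPPSmallPatternKernelSearchStab.lean`; STRUCTURE row B5, the threshold column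
`T1(H) = max {k : (2,1,1)^k ⊆ H}`, lower side of the `k = 6` ORDER LAW `(2,1,1)⁶ ⊆ G ↔ 30 ≤ |G|`), not progress on `ω`: small patterns
in small groups bound no exponent.

Chunks of the kernel mask search `STPP211Neg.search3 (prodGC 3 (zcode 9)) 6` (`decide +kernel`; ≈ 155 s of kernel time predicted); assembled in
`STPPSmallPatternNone211K6P3x9.lean`.  Chunk entries `(d, x1, x2, x3, xg)`: representative `d` of `A₀ = {0, d}`, exclusion masks of the first three levels, global
exclusion mask (`STPPSmallPatternKernelSearchStab.lean`).

References: H. Cohn, R. Kleinberg, B. Szegedy, C. Umans, FOCS 2005 (arXiv:math/0511460), Def. 5.1.  Record: pub-omega HOME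
`pub-omega-eng2-g34/` (ENG2's C mirror `k211g.c` of the kernel tree with the level-1 and global exclusion masks — `k211c.c` of gen 33
validated to the translation count against stpp-3's `k211v3.py` — gives COMPLETE NONE on this cell with 27682100 mask translations over the
canonical first levels; planner `plan3.py`; farm calibration 79 µs per translation; not used by the proofs).
-/

set_option Elab.async false  -- several kernel pieces: elaborate sequentially (memory)

namespace Summit.MatrixMultiplication.OmegaCensus

namespace STPP211Neg

/-- Chunk list 21 of `ℤ/3 × ℤ/9`, `k = 6` (1157802 mask translations in the mirror ≈ 91 s predicted). -/
def P3_9k6.ch21 : List (ℕ × ℕ × ℕ × ℕ × ℕ) :=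
  [(3, 134217725, 134217711, 32767, 1), (3, 134217215, 115043839, 115043839, 115043839)]

/-- Kernel search over chunk list 21 of `ℤ/3 × ℤ/9`, `k = 6`. -/
theorem P3_9k6.s21 : search3 (prodGC 3 (zcode 9)) 6 P3_9k6.ch21 = true := by
  decide +kernel

/-- Chunk list 22 of `ℤ/3 × ℤ/9`, `k = 6` (806284 mask translations in the mirror ≈ 64 s predicted). -/
def P3_9k6.ch22 : List (ℕ × ℕ × ℕ × ℕ × ℕ) :=
  [(9, 134217725, 134217721, 1, 1)]

/-- Kernel search over chunk list 22 of `ℤ/3 × ℤ/9`, `k = 6`. -/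
theorem P3_9k6.s22 : search3 (prodGC 3 (zcode 9)) 6 P3_9k6.ch22 = true := by
  decide +kernel

/-- The chunk lists of this part, concatenated. -/
def P3_9k6.part9 : List (ℕ × ℕ × ℕ × ℕ × ℕ) :=
  P3_9k6.ch21 ++ P3_9k6.ch22

/-- The kernel search over this part's chunks (assembled). -/
theorem P3_9k6.ps9 : search3 (prodGC 3 (zcode 9)) 6 P3_9k6.part9 = true := by
  simp only [P3_9k6.part9, search3_append, P3_9k6.s21, P3_9k6.s22, Bool.and_self]

end STPP211Neg

end Summit.MatrixMultiplication.OmegaCensus
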